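import Mathlib.MeasureTheory.Group.Integral
import Mathlib.MeasureTheory.Group.Action
import Mathlib.MeasureTheory.Integral.Prod
import Mathlib.MeasureTheory.Measure.Prod
import HarnessLib

/-!
# Averaging over a subgroup against a weight: the exchange identity
`∫_X b(x) (∫_U Ψ(u • x) du) dν(x) = (∫_U b(u⁻¹ • y) du) · ∫_X Ψ dν`
(Weil (1940), §9; Bourbaki, *Intégration* VII §2; the step "integrate first over `N(K)\N(𝔸)`" of the
unfolding of Rankin–Selberg integrals, Cogdell (2004), §2.2–2.3)

Topic `MeasureTheory/Group`; namespace `Literature.MeasureTheory.Group`. Proof file (theorems only).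
Let a group `G` act measurably on a measure space `(X, ν)` preserving `ν`, let `U ≤ G` be a subgroup
with an s-finite measure `μU` (intended: a closed unimodular subgroup with a Haar measure) and let
`b : X → [0, ∞]` be measurable with CONSTANT subgroup average `∫_U b(u⁻¹ • y) dμU(u) = V` for all
`y` (e.g. a `U(K)`-covering weight on `GL_n(𝔸_K)` for `U = N_n(𝔸_K)`, whose `N_n(𝔸_K)`-average is the
volume of `N_n(K)\N_n(𝔸_K)`). Then:

* `lintegral_mul_lintegral_subgroup_smul_eq` — the `[0, ∞]` identity
  `∫_X b(x) ∫_U F(u • x) dμU dν = ∫_X F(y) (∫_U b(u⁻¹ • y) dμU) dν` for measurable `F, b ≥ 0`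
  (Tonelli and the substitution `x ↦ u⁻¹ • y`);
* `integrable_toReal_mul_comp_smul` — for `V < ∞` and `Ψ : X → ℂ` Borel and `ν`-integrable, the
  function `(u, x) ↦ (b x).toReal · Ψ(u • x)` is integrable on `U × X`;
* `integral_toReal_mul_integral_subgroup_smul_eq` (**main**, Bochner) —
  `∫_X (b x).toReal · (∫_U Ψ(u • x) dμU) dν = V.toReal · ∫_X Ψ dν`.

This is the device by which a factor `Φ'(g)` of an unfolded automorphic integral, multiplied by a
weight realising the quotient by a discrete `U(K)`, is traded for its `U(𝔸)`-period
`∫_{U(K)\U(𝔸)} Φ'(u g) ψ(u) du` (a Whittaker coefficient).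

## References

* A. Weil, *L'intégration dans les groupes topologiques et ses applications* (1940), §9.
* N. Bourbaki, *Intégration*, Ch. VII §2.
* J. W. Cogdell, *Analytic theory of L-functions for GL_n* (2004), §2.2–2.3 [CogdellAnalyticTheory2004].
-/

noncomputable section

open _root_.MeasureTheory _root_.MeasureTheory.Measure Set Filter Function
open scoped ENNReal NNReal

namespace Literature.MeasureTheory.Group

section Exchange

variable {G : Type*} [Group G] {X : Type*} [MulAction G X] [MeasurableSpace X]
  [MeasurableSpace G] [MeasurableSMul₂ G X] [MeasurableInv G]
  (U : Subgroup G) (μU : Measure U) [SFinite μU]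
  (ν : Measure X) [SFinite ν] [SMulInvariantMeasure G X ν]

omit [MeasurableInv G] in
/-- Joint measurability of `(u, x) ↦ u • x` on `U × X`. [folklore] -/
theorem measurable_subgroup_smul : Measurable fun p : U × X => (p.1 : G) • p.2 :=
  (measurable_subtype_coe.comp measurable_fst).smul measurable_snd

/-- Joint measurability of `(u, x) ↦ u⁻¹ • x` on `U × X`. [folklore] -/
theorem measurable_subgroup_inv_smul : Measurable fun p : U × X => ((p.1 : G))⁻¹ • p.2 :=
  ((measurable_subtype_coe.comp measurable_fst).inv).smul measurable_snd

/-- **The exchange identity in `[0, ∞]`**: for measurable `F, b ≥ 0`,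
`∫_X b(x) (∫_U F(u • x) dμU) dν(x) = ∫_X F(y) (∫_U b(u⁻¹ • y) dμU) dν(y)` (Tonelli twice and the
substitution `x = u⁻¹ • y`, `ν` being `G`-invariant). [folklore] -/
theorem lintegral_mul_lintegral_subgroup_smul_eq {F b : X → ℝ≥0∞} (hF : Measurable F)
    (hb : Measurable b) :
    ∫⁻ x, b x * ∫⁻ u : U, F ((u : G) • x) ∂μU ∂ν =
      ∫⁻ y, F y * ∫⁻ u : U, b (((u : G))⁻¹ • y) ∂μU ∂ν := by
  have hsm := measurable_subgroup_smul U (X := X)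
  have hsm' := measurable_subgroup_inv_smul U (X := X)
  have hm1 : Measurable fun p : U × X => b p.2 * F ((p.1 : G) • p.2) :=
    (hb.comp measurable_snd).mul (hF.comp hsm)
  have hm2 : Measurable fun p : U × X => b (((p.1 : G))⁻¹ • p.2) * F p.2 :=
    (hb.comp hsm').mul (hF.comp measurable_snd)
  -- pull `b x` inside and swap
  have h1 : ∫⁻ x, b x * ∫⁻ u : U, F ((u : G) • x) ∂μU ∂ν = ∫⁻ u : U, ∫⁻ x, b x * F ((u : G) • x) ∂ν ∂μU := by
    have h : ∀ x, b x * ∫⁻ u : U, F ((u : G) • x) ∂μU = ∫⁻ u : U, b x * F ((u : G) • x) ∂μU :=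
      fun x => (lintegral_const_mul (b x) (hF.comp (measurable_subtype_coe.smul_const x))).symm
    simp_rw [h]
    exact lintegral_lintegral_swap (hm1.comp measurable_swap).aemeasurable
  -- substitute `x = u⁻¹ • y`
  have h2 : ∀ u : U, ∫⁻ x, b x * F ((u : G) • x) ∂ν = ∫⁻ y, b (((u : G))⁻¹ • y) * F y ∂ν := by
    intro u
    have hmeas : Measurable fun x => b x * F ((u : G) • x) :=
      hb.mul (hF.comp (measurable_const_smul ((u : G))))
    have key := (measurePreserving_smul (((u : G))⁻¹) ν).lintegral_comp hmeas
    simp only [smul_inv_smul] at key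
    exact key.symm
  simp_rw [h1, h2]
  -- swap back and pull `F y` out
  rw [lintegral_lintegral_swap (f := fun (u : U) (y : X) => b (((u : G))⁻¹ • y) * F y) hm2.aemeasurable]
  refine lintegral_congr fun y => ?_
  have hmu : Measurable fun u : U => b (((u : G))⁻¹ • y) :=
    hb.comp ((measurable_subtype_coe.inv).smul_const y)
  rw [lintegral_mul_const (F y) hmu, mul_comm]

/-- **Integrability on `U × X`** of `(u, x) ↦ (b x).toReal · Ψ(u • x)` for `Ψ ∈ L¹(ν)` Borel, when
the subgroup averages `∫_U b(u⁻¹ • y) dμU` are bounded by `V < ∞`: by the `[0, ∞]` identity the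
double integral of the norm is at most `V ∫ ‖Ψ‖ dν`. [folklore] -/
theorem integrable_toReal_mul_comp_smul {b : X → ℝ≥0∞} (hb : Measurable b) {V : ℝ≥0∞} (hV : V ≠ ∞)
    (hbV : ∀ y, ∫⁻ u : U, b (((u : G))⁻¹ • y) ∂μU ≤ V)
    {Ψ : X → ℂ} (hΨm : Measurable Ψ) (hΨ : Integrable Ψ ν) :
    Integrable (fun p : U × X => ((b p.2).toReal : ℂ) * Ψ ((p.1 : G) • p.2)) (μU.prod ν) := by
  have hsm := measurable_subgroup_smul U (X := X)
  have hm : Measurable fun p : U × X => ((b p.2).toReal : ℂ) * Ψ ((p.1 : G) • p.2) :=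
    (Complex.measurable_ofReal.comp ((hb.comp measurable_snd).ennreal_toReal)).mul (hΨm.comp hsm)
  refine ⟨hm.aestronglyMeasurable, ?_⟩
  -- the norm is dominated by `b x * ‖Ψ(u • x)‖ₑ`
  have hdom : ∀ p : U × X, ‖((b p.2).toReal : ℂ) * Ψ ((p.1 : G) • p.2)‖ₑ ≤ b p.2 * ‖Ψ ((p.1 : G) • p.2)‖ₑ := by
    intro p
    rw [enorm_mul, ← ofReal_norm (((b _).toReal : ℂ)), Complex.norm_real,
      Real.norm_of_nonneg ENNReal.toReal_nonneg]
    gcongr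
    exact ENNReal.ofReal_toReal_le
  have hF : Measurable fun x => ‖Ψ x‖ₑ := hΨm.enorm
  calc ∫⁻ p, ‖((b p.2).toReal : ℂ) * Ψ ((p.1 : G) • p.2)‖ₑ ∂(μU.prod ν)
      ≤ ∫⁻ p, b p.2 * ‖Ψ ((p.1 : G) • p.2)‖ₑ ∂(μU.prod ν) := lintegral_mono hdom
    _ = ∫⁻ u : U, ∫⁻ x, b x * ‖Ψ ((u : G) • x)‖ₑ ∂ν ∂μU :=
        lintegral_prod _ ((hb.comp measurable_snd).mul (hF.comp hsm)).aemeasurable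
    _ = ∫⁻ x, ∫⁻ u : U, b x * ‖Ψ ((u : G) • x)‖ₑ ∂μU ∂ν :=
        (lintegral_lintegral_swap (f := fun (x : X) (u : U) => b x * ‖Ψ ((u : G) • x)‖ₑ)
          (((hb.comp measurable_snd).mul (hF.comp hsm)).comp measurable_swap).aemeasurable).symm
    _ = ∫⁻ x, b x * ∫⁻ u : U, ‖Ψ ((u : G) • x)‖ₑ ∂μU ∂ν := by
        refine lintegral_congr fun x => ?_
        exact lintegral_const_mul (b x) (hF.comp (measurable_subtype_coe.smul_const x))
    _ = ∫⁻ y, ‖Ψ y‖ₑ * ∫⁻ u : U, b (((u : G))⁻¹ • y) ∂μU ∂ν :=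
        lintegral_mul_lintegral_subgroup_smul_eq U μU ν hF hb
    _ ≤ ∫⁻ y, ‖Ψ y‖ₑ * V ∂ν := lintegral_mono fun y => mul_le_mul_right (hbV y) _
    _ = (∫⁻ y, ‖Ψ y‖ₑ ∂ν) * V := lintegral_mul_const V hF
    _ < ∞ := ENNReal.mul_lt_top hΨ.2 hV.lt_top

omit [SMulInvariantMeasure G X ν] in
/-- **Integrability on `U × X`** of `(u, y) ↦ (b (u⁻¹ • y)).toReal · Ψ(y)` for `Ψ ∈ L¹(ν)` Borel,
when the subgroup averages `∫_U b(u⁻¹ • y) dμU` are bounded by `V < ∞` (Tonelli directly). [folklore] -/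
theorem integrable_toReal_comp_inv_smul_mul {b : X → ℝ≥0∞} (hb : Measurable b) {V : ℝ≥0∞} (hV : V ≠ ∞)
    (hbV : ∀ y, ∫⁻ u : U, b (((u : G))⁻¹ • y) ∂μU ≤ V)
    {Ψ : X → ℂ} (hΨm : Measurable Ψ) (hΨ : Integrable Ψ ν) :
    Integrable (fun p : U × X => ((b (((p.1 : G))⁻¹ • p.2)).toReal : ℂ) * Ψ p.2) (μU.prod ν) := by
  have hsm' := measurable_subgroup_inv_smul U (X := X)
  have hm : Measurable fun p : U × X => ((b (((p.1 : G))⁻¹ • p.2)).toReal : ℂ) * Ψ p.2 :=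
    (Complex.measurable_ofReal.comp ((hb.comp hsm').ennreal_toReal)).mul (hΨm.comp measurable_snd)
  refine ⟨hm.aestronglyMeasurable, ?_⟩
  have hdom : ∀ p : U × X, ‖((b (((p.1 : G))⁻¹ • p.2)).toReal : ℂ) * Ψ p.2‖ₑ ≤
      b (((p.1 : G))⁻¹ • p.2) * ‖Ψ p.2‖ₑ := by
    intro p
    rw [enorm_mul, ← ofReal_norm (((b _).toReal : ℂ)), Complex.norm_real,
      Real.norm_of_nonneg ENNReal.toReal_nonneg]
    gcongr
    exact ENNReal.ofReal_toReal_le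
  have hF : Measurable fun x => ‖Ψ x‖ₑ := hΨm.enorm
  have hm2 : Measurable fun p : U × X => b (((p.1 : G))⁻¹ • p.2) * ‖Ψ p.2‖ₑ :=
    (hb.comp hsm').mul (hF.comp measurable_snd)
  calc ∫⁻ p, ‖((b (((p.1 : G))⁻¹ • p.2)).toReal : ℂ) * Ψ p.2‖ₑ ∂(μU.prod ν)
      ≤ ∫⁻ p, b (((p.1 : G))⁻¹ • p.2) * ‖Ψ p.2‖ₑ ∂(μU.prod ν) := lintegral_mono hdom
    _ = ∫⁻ u : U, ∫⁻ y, b (((u : G))⁻¹ • y) * ‖Ψ y‖ₑ ∂ν ∂μU := lintegral_prod _ hm2.aemeasurable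
    _ = ∫⁻ y, ∫⁻ u : U, b (((u : G))⁻¹ • y) * ‖Ψ y‖ₑ ∂μU ∂ν :=
        lintegral_lintegral_swap (f := fun (u : U) (y : X) => b (((u : G))⁻¹ • y) * ‖Ψ y‖ₑ) hm2.aemeasurable
    _ = ∫⁻ y, (∫⁻ u : U, b (((u : G))⁻¹ • y) ∂μU) * ‖Ψ y‖ₑ ∂ν := by
        refine lintegral_congr fun y => ?_
        have hmu : Measurable fun u : U => b (((u : G))⁻¹ • y) :=
          hb.comp ((measurable_subtype_coe.inv).smul_const y)
        exact lintegral_mul_const _ hmu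
    _ ≤ ∫⁻ y, V * ‖Ψ y‖ₑ ∂ν := lintegral_mono fun y => mul_le_mul_left (hbV y) _
    _ = V * ∫⁻ y, ‖Ψ y‖ₑ ∂ν := lintegral_const_mul V hF
    _ < ∞ := ENNReal.mul_lt_top hV.lt_top hΨ.2

/-- **The exchange identity for integrable functions (Bochner form).** With `b : X → [0, ∞]`
measurable of constant finite subgroup average `∫_U b(u⁻¹ • y) dμU = V < ∞` and `Ψ : X → ℂ` Borel and
`ν`-integrable: `∫_X (b x).toReal · (∫_U Ψ(u • x) dμU) dν(x) = V.toReal · ∫_X Ψ dν` (Fubini on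
`U × X` twice and the substitution `x = u⁻¹ • y`). [folklore] -/
theorem integral_toReal_mul_integral_subgroup_smul_eq {b : X → ℝ≥0∞} (hb : Measurable b) {V : ℝ≥0∞}
    (hV : V ≠ ∞) (hbV : ∀ y, ∫⁻ u : U, b (((u : G))⁻¹ • y) ∂μU = V)
    {Ψ : X → ℂ} (hΨm : Measurable Ψ) (hΨ : Integrable Ψ ν) :
    ∫ x, ((b x).toReal : ℂ) * ∫ u : U, Ψ ((u : G) • x) ∂μU ∂ν = (V.toReal : ℂ) * ∫ y, Ψ y ∂ν := by
  have hint := integrable_toReal_mul_comp_smul U μU ν hb hV (fun y => (hbV y).le) hΨm hΨ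
  have hint' := integrable_toReal_comp_inv_smul_mul U μU ν hb hV (fun y => (hbV y).le) hΨm hΨ
  -- pull `b x` inside and apply Fubini
  have h1 : ∫ x, ((b x).toReal : ℂ) * ∫ u : U, Ψ ((u : G) • x) ∂μU ∂ν =
      ∫ x, ∫ u : U, ((b x).toReal : ℂ) * Ψ ((u : G) • x) ∂μU ∂ν := by
    refine integral_congr_ae (Eventually.of_forall fun x => ?_)
    exact (integral_const_mul _ _).symm
  rw [h1, integral_integral_swap (f := fun x (u : U) => ((b x).toReal : ℂ) * Ψ ((u : G) • x)) hint.swap]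
  -- substitute `x = u⁻¹ • y` in the inner integral
  have h2 : ∀ u : U, ∫ x, ((b x).toReal : ℂ) * Ψ ((u : G) • x) ∂ν =
      ∫ y, ((b (((u : G))⁻¹ • y)).toReal : ℂ) * Ψ y ∂ν := by
    intro u
    have key := integral_smul_eq_self (μ := ν) (fun x => ((b x).toReal : ℂ) * Ψ ((u : G) • x))
      (g := ((u : G))⁻¹)
    simp only [smul_inv_smul] at key
    exact key.symm
  simp_rw [h2]
  -- swap again and evaluate the inner integral
  rw [integral_integral_swap (f := fun (u : U) y => ((b (((u : G))⁻¹ • y)).toReal : ℂ) * Ψ y) hint']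
  have h3 : ∀ y, ∫ u : U, ((b (((u : G))⁻¹ • y)).toReal : ℂ) * Ψ y ∂μU = (V.toReal : ℂ) * Ψ y := by
    intro y
    have hmu : Measurable fun u : U => b (((u : G))⁻¹ • y) :=
      hb.comp ((measurable_subtype_coe.inv).smul_const y)
    rw [integral_mul_const, integral_complex_ofReal, integral_toReal hmu.aemeasurable
      (ae_lt_top hmu (by rw [hbV y]; exact hV)), hbV y]
  simp_rw [h3]
  exact integral_const_mul _ _

end Exchange

end Literature.MeasureTheory.Group
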